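import Summits.HodgeConjecture.HodgeConjecture.Theorems.F0P3FinPartIsotypic              -- I♭ automorphic half (this seat, p812320): `isotypicComponent_finRep_smoothPart_eq_top`
import Summits.HodgeConjecture.HodgeConjecture.Theorems.F0P3FinRepConstituentsExist      -- ★ p812012 (p04 g5): `isConstituentOf_finRepSmooth_comp_of_hasFinComponent` (easy direction)
import Literature.NumberTheory.Automorphic.IrreducibleClassesConstituentsIsotypic        -- ★ Σ♭ (p04 g5): `IsConstituentOf.of_isotypicComponent_eq_top_comp`
import HarnessLib

/-!
# Crux `H413` — rung 3, T♭-CORE: discrete automorphic representations of `U(J)` with a COMMON irreducible admissible finite component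
# have the SAME local constituents at every finite place (smooth-part currency (b2′))

Floor-0 programme P3 «U3-mult», seat F0P3-p03 (g5); crux item stmt-HodgeConjecture-24833 (`HCCMUnconditional.H413`); F0P3-plan (g3)
rulings (N6)/(R)/(T) 2026-08-31: the in-house TRANSFER T♭ («`MemXiFamily P ξ`, common `σ` ⇒ `MemXiFamily P′ ξ`») replaces the letter S3♭
[Rogawski1990 Thm. 13.3.5 / 14.6.4 proof l. 1] in the β_opp fold (★ `betaOpp(Adm)_pointwise_of_SLayer_trans`); this file is its
vocabulary-free CORE — D6 `MemXiFamily` only adds «constituents ∈ members» on top (typ3 step (5)).  PROOF lane: no `def`, no `sorry`, no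
named fact; `--supports stmt-HodgeConjecture-24833`.  HONEST LABEL: HC_CM is proved only modulo the printed citations until rung 0 closes;
this file discharges none of them.

THE ARGUMENT = I♭ + Σ♭ + inheritance: for `σ` irreducible ADMISSIBLE occurring in both `P` and `P′` (★ `HasFinComponent`), the smooth part
of `P′|_{U(J)(𝔸_{F,f})}` is `σ`-isotypic (★ I♭ `isotypicComponent_finRep_smoothPart_eq_top`), so every constituent class of its restriction
to `U(J)(F_v)` (along ★ `inclPlace v`) is a constituent class of `σ|_{U(J)(F_v)}` (★ Σ♭ `IsConstituentOf.of_isotypicComponent_eq_top_comp` —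
the isotypy is only `U(J)(𝔸_{F,f})`-equivariant, the subquotients are `U(J)(F_v)`-stable; Σ♭ handles exactly this), and those are constituent
classes of the smooth part of `P|_{U(J)(𝔸_{F,f})}` restricted to `U(J)(F_v)` since `σ` embeds there (★ `isConstituentOf_finRepSmooth_comp_of_hasFinComponent`).

* `smoothConstituents_iff_of_hasFinComponent` — the constituents of `P.finRep^∞ ∘ inclPlace v` are EXACTLY those of `σ ∘ inclPlace v`.
* **`smoothConstituents_transfer`** (T♭-core, generic frame `F E c N J`) and `smoothConstituents_iff` (`P` vs `P′`).
* `comap_smoothConstituents_transfer_cm` — the CM frame in D6 (b2′)'s binder types VERBATIM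
  (`(IrrClass.comap (localPiEquiv L c̄ 3 H v) c).IsConstituentOf (P.finRep.smoothPart.toRepresentation.comp (inclPlace L⁺ L c̄ 3 H v))`).

ADMISSIBILITY of `σ` is load-bearing (it makes `cl(T f W) ∩ (P.space)^∞ ⊆ T f W` in I♭); CONTRACT v7 `StubBetaOppAdm` carries it as a binder
(F0P3-plan (g3) ruling (R-b)), discharged at the pin for cohomological `P` by ★ K1″ `F0P3StubBetaOppAdmFold` (p02 (g5)).

References: D. Flath, PSPM 33.1 (1979) Thm. 3–4 [FlathCorvallis1979]; A. Borel, H. Jacquet, PSPM 33.1 (1979) §4.6 [BorelJacquet1979];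
N. Bourbaki, *Algèbre* VIII (2012) §4 n°1–2 [BourbakiAlgebreVIII2012]; J. Rogawski, Ann. of Math. Stud. 123 (1990) Thm. 13.3.5, §14.6 (the
statement T♭ replaces) [Rogawski1990].
-/

set_option autoImplicit false
-- the mandated namespace repeats `HodgeConjecture.HodgeConjecture`, as in every `Theorems/*.lean` of this sub-problem
set_option linter.dupNamespace false

noncomputable section

open scoped MonoidAlgebra
open MeasureTheory NumberField IsDedekindDomain

namespace Summit.HodgeConjecture.HodgeConjecture.Cruxes.H413.F0P3FinPartConstituentTransfer

open Literature.NumberTheory.Automorphic Literature.NumberTheory.Automorphic.UnitaryGroup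
open Summit.HodgeConjecture.HodgeConjecture.Cruxes.H413.F0P3FinPartIsotypic
open Summit.HodgeConjecture.HodgeConjecture.Cruxes.H413.F0P3FinRepConstituentsExist

/-! ## §1 Generic frame `F E c N J` -/

section Generic

variable {F E : Type} [Field F] [NumberField F] [Field E] [NumberField E] [Algebra F E] {c : E ≃ₐ[F] E} {N : ℕ}
  {J : Matrix (Fin N) (Fin N) E}
  {μ : Measure (adelicGroupData F E c N J).automorphicQuotient}
  [SMulInvariantMeasure (adelicGroupData F E c N J).Adelic (adelicGroupData F E c N J).automorphicQuotient μ]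

/-- **The local constituents of `P` are those of its finite component**: for `σ` irreducible ADMISSIBLE occurring in `P`, a class
`c₀ ∈ Irr(U(J)(F_v))` is a constituent of `P.finRep^∞ ∘ inclPlace v` iff it is a constituent of `σ ∘ inclPlace v` (→: ★ I♭ isotypy + ★ Σ♭;
←: `σ ↪ P.finRep^∞`, ★ `isConstituentOf_finRepSmooth_comp_of_hasFinComponent`). [cite: FlathCorvallis1979, Thm. 3] [cite: BourbakiAlgebreVIII2012, VIII §4 n°2] -/
theorem smoothConstituents_iff_of_hasFinComponent (P : DiscreteAutomorphicRep (adelicGroupData F E c N J) μ)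
    {W : Type} [AddCommGroup W] [Module ℂ W] {σ : Representation ℂ (finAdelic F E c N J) W}
    (hirr : σ.IsIrreducible) (hadm : σ.IsAdmissible) (hP : P.HasFinComponent σ)
    (v : HeightOneSpectrum (𝓞 F)) (c₀ : IrrClass ↥(localPi E c N J v)) :
    c₀.IsConstituentOf (P.finRep.smoothPart.toRepresentation.comp (inclPlace F E c N J v)) ↔
      c₀.IsConstituentOf (σ.comp (inclPlace F E c N J v)) := by
  haveI : IsSimpleModule ℂ[finAdelic F E c N J] σ.asModule := (Representation.irreducible_iff_isSimpleModule_asModule σ).mp hirr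
  refine ⟨fun h => ?_, fun h => isConstituentOf_finRepSmooth_comp_of_hasFinComponent P hadm.isSmooth hP h⟩
  exact IrrClass.IsConstituentOf.of_isotypicComponent_eq_top_comp (isotypicComponent_finRep_smoothPart_eq_top P σ hirr hadm hP)
    (inclPlace F E c N J v) h

/-- **T♭-CORE — TRANSFER OF LOCAL CONSTITUENTS ACROSS A COMMON FINITE COMPONENT.**  If the irreducible ADMISSIBLE `σ` occurs in both discrete
automorphic `P` and `P′` of `U(J)`, then at every finite place `v` every constituent class of `P′.finRep^∞ ∘ inclPlace v` is a constituent class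
of `P.finRep^∞ ∘ inclPlace v`. [cite: FlathCorvallis1979, Thm. 3] [cite: BorelJacquet1979, §4.6] [cite: BourbakiAlgebreVIII2012, VIII §4 n°2] -/
theorem smoothConstituents_transfer (P P' : DiscreteAutomorphicRep (adelicGroupData F E c N J) μ)
    {W : Type} [AddCommGroup W] [Module ℂ W] {σ : Representation ℂ (finAdelic F E c N J) W}
    (hirr : σ.IsIrreducible) (hadm : σ.IsAdmissible) (hP : P.HasFinComponent σ) (hP' : P'.HasFinComponent σ)
    (v : HeightOneSpectrum (𝓞 F)) {c₀ : IrrClass ↥(localPi E c N J v)}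
    (h : c₀.IsConstituentOf (P'.finRep.smoothPart.toRepresentation.comp (inclPlace F E c N J v))) :
    c₀.IsConstituentOf (P.finRep.smoothPart.toRepresentation.comp (inclPlace F E c N J v)) :=
  (smoothConstituents_iff_of_hasFinComponent P hirr hadm hP v c₀).mpr
    ((smoothConstituents_iff_of_hasFinComponent P' hirr hadm hP' v c₀).mp h)

/-- **Same local constituents**: under a common irreducible admissible finite component, `P` and `P′` have the SAME constituent classes at
every finite place (smooth-part currency). [cite: FlathCorvallis1979, Thm. 3] [cite: BourbakiAlgebreVIII2012, VIII §4 n°2] -/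
theorem smoothConstituents_iff (P P' : DiscreteAutomorphicRep (adelicGroupData F E c N J) μ)
    {W : Type} [AddCommGroup W] [Module ℂ W] {σ : Representation ℂ (finAdelic F E c N J) W}
    (hirr : σ.IsIrreducible) (hadm : σ.IsAdmissible) (hP : P.HasFinComponent σ) (hP' : P'.HasFinComponent σ)
    (v : HeightOneSpectrum (𝓞 F)) (c₀ : IrrClass ↥(localPi E c N J v)) :
    c₀.IsConstituentOf (P.finRep.smoothPart.toRepresentation.comp (inclPlace F E c N J v)) ↔
      c₀.IsConstituentOf (P'.finRep.smoothPart.toRepresentation.comp (inclPlace F E c N J v)) :=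
  ⟨smoothConstituents_transfer P' P hirr hadm hP' hP v, smoothConstituents_transfer P P' hirr hadm hP hP' v⟩

end Generic

/-! ## §2 The CM frame, in D6 (b2′)'s binder types -/

section CM

variable {L : Type} [Field L] [NumberField L] [IsCMField L] {H : Matrix (Fin 3) (Fin 3) L}
  {μ : Measure (adelicGroupData (↥(maximalRealSubfield L)) L (IsCMField.complexConj L) 3 H).automorphicQuotient}
  [SMulInvariantMeasure (adelicGroupData (↥(maximalRealSubfield L)) L (IsCMField.complexConj L) 3 H).Adelic
    (adelicGroupData (↥(maximalRealSubfield L)) L (IsCMField.complexConj L) 3 H).automorphicQuotient μ]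

/-- **T♭-core at the CM frame, D6 (b2′) currency VERBATIM**: for discrete automorphic `P`, `P′` of `U(H)`, `H ∈ M₃(L)`, with a common
irreducible ADMISSIBLE finite component `σ`, and every finite place `v` of `L⁺` and class `c : IrrClass ((cmDatum L 3 H).Local v)`: if the
pull-back of `c` along ★ `localPiEquiv v` is a constituent of `P′.finRep^∞ ∘ inclPlace v`, it is a constituent of `P.finRep^∞ ∘ inclPlace v` —
so `P.LocalConstituentsIn Πv → P′.LocalConstituentsIn Πv` for any family `Πv` of local packets. [cite: FlathCorvallis1979, Thm. 3]
[cite: BourbakiAlgebreVIII2012, VIII §4 n°2] -/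
theorem comap_smoothConstituents_transfer_cm
    (P P' : DiscreteAutomorphicRep (adelicGroupData (↥(maximalRealSubfield L)) L (IsCMField.complexConj L) 3 H) μ)
    {W : Type} [AddCommGroup W] [Module ℂ W]
    {σ : Representation ℂ (finAdelic (↥(maximalRealSubfield L)) L (IsCMField.complexConj L) 3 H) W}
    (hirr : σ.IsIrreducible) (hadm : σ.IsAdmissible) (hP : P.HasFinComponent σ) (hP' : P'.HasFinComponent σ)
    (v : HeightOneSpectrum (𝓞 ↥(maximalRealSubfield L))) (c : IrrClass ((cmDatum L 3 H).Local v))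
    (h : (IrrClass.comap (localPiEquiv L (IsCMField.complexConj L) 3 H v) c).IsConstituentOf
      (P'.finRep.smoothPart.toRepresentation.comp (inclPlace (↥(maximalRealSubfield L)) L (IsCMField.complexConj L) 3 H v))) :
    (IrrClass.comap (localPiEquiv L (IsCMField.complexConj L) 3 H v) c).IsConstituentOf
      (P.finRep.smoothPart.toRepresentation.comp (inclPlace (↥(maximalRealSubfield L)) L (IsCMField.complexConj L) 3 H v)) :=
  smoothConstituents_transfer P P' hirr hadm hP hP' v h

/-- **The transfer in `∀`-form over an arbitrary membership test** (the shape of D6's `LocalConstituentsIn`): if every (b2′)-constituent of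
`P` at every finite place satisfies `Q v`, so does every (b2′)-constituent of `P′`. [cite: FlathCorvallis1979, Thm. 3]
[cite: BourbakiAlgebreVIII2012, VIII §4 n°2] -/
theorem forall_comap_smoothConstituents_transfer_cm
    (P P' : DiscreteAutomorphicRep (adelicGroupData (↥(maximalRealSubfield L)) L (IsCMField.complexConj L) 3 H) μ)
    {W : Type} [AddCommGroup W] [Module ℂ W]
    {σ : Representation ℂ (finAdelic (↥(maximalRealSubfield L)) L (IsCMField.complexConj L) 3 H) W}
    (hirr : σ.IsIrreducible) (hadm : σ.IsAdmissible) (hP : P.HasFinComponent σ) (hP' : P'.HasFinComponent σ)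
    {Q : ∀ v : HeightOneSpectrum (𝓞 ↥(maximalRealSubfield L)), IrrClass ((cmDatum L 3 H).Local v) → Prop}
    (hQ : ∀ (v : HeightOneSpectrum (𝓞 ↥(maximalRealSubfield L))) (c : IrrClass ((cmDatum L 3 H).Local v)),
      (IrrClass.comap (localPiEquiv L (IsCMField.complexConj L) 3 H v) c).IsConstituentOf
        (P.finRep.smoothPart.toRepresentation.comp (inclPlace (↥(maximalRealSubfield L)) L (IsCMField.complexConj L) 3 H v)) → Q v c) :
    ∀ (v : HeightOneSpectrum (𝓞 ↥(maximalRealSubfield L))) (c : IrrClass ((cmDatum L 3 H).Local v)),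
      (IrrClass.comap (localPiEquiv L (IsCMField.complexConj L) 3 H v) c).IsConstituentOf
        (P'.finRep.smoothPart.toRepresentation.comp (inclPlace (↥(maximalRealSubfield L)) L (IsCMField.complexConj L) 3 H v)) → Q v c :=
  fun v c h => hQ v c (comap_smoothConstituents_transfer_cm P P' hirr hadm hP hP' v c h)

end CM

end Summit.HodgeConjecture.HodgeConjecture.Cruxes.H413.F0P3FinPartConstituentTransfer

end
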